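import Summits.KontsevichZagierPeriods.KontsevichZagierPeriods.Theorems.RootDecompRelativeModAbsoluteCircleSplitP06

/-! # `RootDecompRelativeModAbsoluteCircleSplitP07` — part 7/11 of the mechanical ≤400-line split of `csk_min.lean` (sha256 066c56c743abe73e…)
Source: decomp-kz lens-3 g14 CircleSplitK.lean @3d3b9378 (= CircleSplit @d1112051 §0–§25 + §26 kernel split + §27 odd→log; critic CLEARED g6-21 l.1371, g7-2 l.1388) minus the 65 declarations already landed in …CircleLogP1–P11 / …CylLogSplitP46–P49 and minus the 20 superseded g13-glue/tame-class lemmas not on the §26–§27 chain; imports …CylLogSplitP48 + …CircleLogP11; --supports stmt-KontsevichZagierPeriods-30572.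
Split by census-1 g10 `gen/splitlean.py`: scopes re-opened with their `open`/`variable`/`set_option` context; mathematics and declaration order unchanged. -/

noncomputable section
open Set MeasureTheory Filter Topology
open scoped BigOperators
open Literature.NumberTheory.Transcendental Literature.ModelTheory.ExponentialFields
namespace Summit.KontsevichZagierPeriods.RootDecompRelativeModAbsolute.Rung30571.RegularisedLogLayer.CylLog.Leaf
namespace G13
variable {b : ℕ}

/-- The right-hand side of the differentiated identity (§20) is `ℚ`-sa when the data are (derivatives of `ℚ`-sa functions along
`Pi.single 0 1` are `ℚ`-sa, tree `IsSemialgebraicFunOn.fderiv_apply_single`). -/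
theorem isSemialgebraicFunOn_fderiv_rhs {d k l : ℕ} {U : Set (Fin d → ℝ)} (hU : IsSemialgebraic ℚ U) (hUo : IsOpen U)
    {H W : Fin k → (Fin d → ℝ) → ℝ} {P u : Fin l → (Fin d → ℝ) → ℝ} {G : (Fin d → ℝ) → ℝ}
    (hH : ∀ i, IsSemialgebraicFunOn ℚ U (H i)) (hW : ∀ i, IsSemialgebraicFunOn ℚ U (W i))
    (hW0 : ∀ i, ∀ x ∈ U, 0 < W i x)
    (hP : ∀ j, IsSemialgebraicFunOn ℚ U (P j)) (hu : ∀ j, IsSemialgebraicFunOn ℚ U (u j))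
    (hG : IsSemialgebraicFunOn ℚ U G)
    (hWd : ∀ i, ∀ x ∈ U, DifferentiableAt ℝ (W i) x) (hud : ∀ j, ∀ x ∈ U, DifferentiableAt ℝ (u j) x)
    (hGd : ∀ x ∈ U, DifferentiableAt ℝ G x) (e : Fin d) :
    IsSemialgebraicFunOn ℚ U fun x => fderiv ℝ G x (Pi.single e 1) -
      ∑ i, H i x * (fderiv ℝ (W i) x (Pi.single e 1) / W i x) -
      ∑ j, P j x * (fderiv ℝ (u j) x (Pi.single e 1) / (1 + u j x ^ 2)) := by
  classical
  have hdG : IsSemialgebraicFunOn ℚ U (fun x => fderiv ℝ G x (Pi.single e 1)) :=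
    IsSemialgebraicFunOn.fderiv_apply_single hUo hG hGd e
  have hdW : ∀ i, IsSemialgebraicFunOn ℚ U (fun x => fderiv ℝ (W i) x (Pi.single e 1)) := fun i =>
    IsSemialgebraicFunOn.fderiv_apply_single hUo (hW i) (hWd i) e
  have hdu : ∀ j, IsSemialgebraicFunOn ℚ U (fun x => fderiv ℝ (u j) x (Pi.single e 1)) := fun j =>
    IsSemialgebraicFunOn.fderiv_apply_single hUo (hu j) (hud j) e
  have h1 : ∀ i, IsSemialgebraicFunOn ℚ U (fun x => H i x * (fderiv ℝ (W i) x (Pi.single e 1) / W i x)) := fun i =>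
    (IsSemialgebraicFunOn.mul_holds (hH i) ((hdW i).div (hW i) fun x hx => (hW0 i x hx).ne')).congr fun x _ => by
      simp only [Pi.mul_apply]
  have hden : ∀ j, IsSemialgebraicFunOn ℚ U (fun x => 1 + u j x ^ 2) := fun j =>
    (IsSemialgebraicFunOn.add_holds (isSemialgebraicFunOn_const_ratCast hU 1)
      (IsSemialgebraicFunOn.mul_holds (hu j) (hu j))).congr fun x _ => by
      simp only [Pi.add_apply, Pi.mul_apply]; push_cast; ring
  have h2 : ∀ j, IsSemialgebraicFunOn ℚ U
      (fun x => P j x * (fderiv ℝ (u j) x (Pi.single e 1) / (1 + u j x ^ 2))) := fun j =>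
    (IsSemialgebraicFunOn.mul_holds (hP j) ((hdu j).div (hden j) fun x _ => by positivity)).congr fun x _ => by
      simp only [Pi.mul_apply]
  have hs1 : IsSemialgebraicFunOn ℚ U (fun x => ∑ i, H i x * (fderiv ℝ (W i) x (Pi.single e 1) / W i x)) :=
    KZ.isSemialgebraicFunOn_finset_sum Finset.univ hU fun i _ => h1 i
  have hs2 : IsSemialgebraicFunOn ℚ U
      (fun x => ∑ j, P j x * (fderiv ℝ (u j) x (Pi.single e 1) / (1 + u j x ^ 2))) :=
    KZ.isSemialgebraicFunOn_finset_sum Finset.univ hU fun j _ => h2 j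
  exact (IsSemialgebraicFunOn.sub_holds (IsSemialgebraicFunOn.sub_holds hdG hs1) hs2).congr fun x _ => by
    simp only [Pi.sub_apply]

/-! #### §24c Consuming the induction hypothesis: a coefficient `≡ 0` ⇒ drop (§22) ⇒ lower level ⇒ translate back (§23). -/

/-- If some LOG coefficient vanishes identically, the level-`(k, l)` conclusion follows from the lower levels. -/
theorem exact_of_zeroLog {k l : ℕ} (IH : ∀ k' l', k' + l' < k + l → ExactLevel k' l')
    {U : Set (Fin 1 → ℝ)} (hU : IsSemialgebraic ℚ U)
    {h W : Fin k → (Fin 1 → ℝ) → ℝ} {p u : Fin l → (Fin 1 → ℝ) → ℝ} {g : (Fin 1 → ℝ) → ℝ}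
    (hh : ∀ i, IsSemialgebraicFunOn ℚ U (h i)) (hW : ∀ i, IsSemialgebraicFunOn ℚ U (W i))
    (hW0 : ∀ i, ∀ x ∈ U, 0 < W i x)
    (hp : ∀ j, IsSemialgebraicFunOn ℚ U (p j)) (hu : ∀ j, IsSemialgebraicFunOn ℚ U (u j))
    (hg : IsSemialgebraicFunOn ℚ U g)
    (hid : ∀ x ∈ U, ∑ i, h i x * Real.log (W i x) + ∑ j, p j x * Real.arctan (u j x) = g x)
    (i₀ : Fin k) (hz : ∀ x ∈ U, h i₀ x = 0) : CircleStructExactOn k l U h W p u g := by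
  cases k with
  | zero => exact i₀.elim0
  | succ k' =>
    exact circleStructExact_dropLog i₀ hz
      (IH k' l (by omega) U (fun i => h (i₀.succAbove i)) (fun i => W (i₀.succAbove i)) p u g hU
        (fun i => hh _) (fun i => hW _) (fun i => hW0 _) hp hu hg (circle_identity_dropLog i₀ hz hid))

/-- If some ANGLE coefficient vanishes identically, the level-`(k, l)` conclusion follows from the lower levels. -/
theorem exact_of_zeroAngle {k l : ℕ} (IH : ∀ k' l', k' + l' < k + l → ExactLevel k' l')
    {U : Set (Fin 1 → ℝ)} (hU : IsSemialgebraic ℚ U)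
    {h W : Fin k → (Fin 1 → ℝ) → ℝ} {p u : Fin l → (Fin 1 → ℝ) → ℝ} {g : (Fin 1 → ℝ) → ℝ}
    (hh : ∀ i, IsSemialgebraicFunOn ℚ U (h i)) (hW : ∀ i, IsSemialgebraicFunOn ℚ U (W i))
    (hW0 : ∀ i, ∀ x ∈ U, 0 < W i x)
    (hp : ∀ j, IsSemialgebraicFunOn ℚ U (p j)) (hu : ∀ j, IsSemialgebraicFunOn ℚ U (u j))
    (hg : IsSemialgebraicFunOn ℚ U g)
    (hid : ∀ x ∈ U, ∑ i, h i x * Real.log (W i x) + ∑ j, p j x * Real.arctan (u j x) = g x)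
    (j₀ : Fin l) (hz : ∀ x ∈ U, p j₀ x = 0) : CircleStructExactOn k l U h W p u g := by
  cases l with
  | zero => exact j₀.elim0
  | succ l' =>
    exact circleStructExact_dropAngle j₀ hz
      (IH k l' (by omega) U h W (fun j => p (j₀.succAbove j)) (fun j => u (j₀.succAbove j)) g hU
        hh hW hW0 (fun j => hp _) (fun j => hu _) hg (circle_identity_dropAngle j₀ hz hid))

/-! #### §24d From EXACT structure data for the derivatives of the normalised coefficients to EXACT structure (cases (a)/(b)/(b′)). -/

/-- **The core of the round.**  On `U ⊆ ℝ¹` let `hᵢ = φ·Hᵢ`, `pⱼ = φ·Pⱼ` with `φ` `ℚ`-sa nowhere `0` and `Hᵢ, Pⱼ`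
differentiable with `ℚ`-sa derivatives `dHᵢ, dPⱼ`, and suppose EXACT structure data are known for SOME identity with coefficients
`dH, dP` (same `W, u`).  On each of its cells, refined to interval cells where every `dHᵢ, dPⱼ` is `≡ 0` or nowhere `0` (§24a): all
`≡ 0` ⇒ `H, P` constant (§10c) ⇒ §18/§23 `circleStructExact_projConstCoeff`; some `dH_{i₁}` nowhere `0` ⇒ a returned EXACT relation
`f` has `f i₁ ≠ 0` ⇒ eliminate (§21) ⇒ drop + induction hypothesis (§24c) ⇒ translate back (§23 `circleStructExact_elimLog`); angle twin. -/
theorem circleStructExact_of_derivData {k l : ℕ} (IH : ∀ k' l', k' + l' < k + l → ExactLevel k' l')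
    {U : Set (Fin 1 → ℝ)}
    {h W : Fin k → (Fin 1 → ℝ) → ℝ} {p u : Fin l → (Fin 1 → ℝ) → ℝ} {g : (Fin 1 → ℝ) → ℝ}
    (hh : ∀ i, IsSemialgebraicFunOn ℚ U (h i)) (hW : ∀ i, IsSemialgebraicFunOn ℚ U (W i))
    (hW0 : ∀ i, ∀ x ∈ U, 0 < W i x)
    (hp : ∀ j, IsSemialgebraicFunOn ℚ U (p j)) (hu : ∀ j, IsSemialgebraicFunOn ℚ U (u j))
    (hg : IsSemialgebraicFunOn ℚ U g)
    (hWd : ∀ i, ∀ x ∈ U, DifferentiableAt ℝ (W i) x) (hud : ∀ j, ∀ x ∈ U, DifferentiableAt ℝ (u j) x)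
    (hid : ∀ x ∈ U, ∑ i, h i x * Real.log (W i x) + ∑ j, p j x * Real.arctan (u j x) = g x)
    {φ : (Fin 1 → ℝ) → ℝ} (hφ : IsSemialgebraicFunOn ℚ U φ) (hφ0 : ∀ x ∈ U, φ x ≠ 0)
    {H : Fin k → (Fin 1 → ℝ) → ℝ} {P : Fin l → (Fin 1 → ℝ) → ℝ}
    (hhH : ∀ i, ∀ x ∈ U, h i x = φ x * H i x) (hpP : ∀ j, ∀ x ∈ U, p j x = φ x * P j x)
    (hHd : ∀ i, ∀ x ∈ U, DifferentiableAt ℝ (H i) x) (hPd : ∀ j, ∀ x ∈ U, DifferentiableAt ℝ (P j) x)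
    {dH : Fin k → (Fin 1 → ℝ) → ℝ} {dP : Fin l → (Fin 1 → ℝ) → ℝ}
    (hdH : ∀ i, ∀ x ∈ U, dH i x = fderiv ℝ (H i) x (Pi.single 0 1))
    (hdP : ∀ j, ∀ x ∈ U, dP j x = fderiv ℝ (P j) x (Pi.single 0 1))
    (hdHsa : ∀ i, IsSemialgebraicFunOn ℚ U (dH i)) (hdPsa : ∀ j, IsSemialgebraicFunOn ℚ U (dP j))
    {g₁ : (Fin 1 → ℝ) → ℝ} (hE₁ : CircleStructExactOn k l U dH W dP u g₁) :
    CircleStructExactOn k l U h W p u g := by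
  classical
  obtain ⟨N₁, J, hJ, hJd, hJn, hJdata⟩ := hE₁
  refine circleStructExact_of_cells (G := U) subset_rfl (by simp) J (fun c => (hJ c).2.2) hJd hJn fun c => ?_
  obtain ⟨-, R, f, q, S, f', q', -, hrel, hdHq, -, hrel', hdPq⟩ := hJdata c
  obtain ⟨hJsa, hJo, hJU⟩ := hJ c
  -- refine `J c` to interval cells on which every `dH i`, `dP j` is `≡ 0` or nowhere `0`
  refine circleStructExact_localise hJsa (m' := 0) Fin.elim0 (fun j => j.elim0) (Fin.append dH dP) ?_ ?_
  · intro t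
    induction t using Fin.addCases with
    | left i => simpa only [Fin.append_left] using (hdHsa i).mono hJU hJsa
    | right j => simpa only [Fin.append_right] using (hdPsa j).mono hJU hJsa
  intro T hTJ hTsa hTo hTc _ hdich
  have hTU : T ⊆ U := hTJ.trans hJU
  -- restrictions to `T`
  have hhT : ∀ i, IsSemialgebraicFunOn ℚ T (h i) := fun i => (hh i).mono hTU hTsa
  have hWT : ∀ i, IsSemialgebraicFunOn ℚ T (W i) := fun i => (hW i).mono hTU hTsa
  have hW0T : ∀ i, ∀ x ∈ T, 0 < W i x := fun i x hx => hW0 i x (hTU hx)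
  have hpT : ∀ j, IsSemialgebraicFunOn ℚ T (p j) := fun j => (hp j).mono hTU hTsa
  have huT : ∀ j, IsSemialgebraicFunOn ℚ T (u j) := fun j => (hu j).mono hTU hTsa
  have hgT : IsSemialgebraicFunOn ℚ T g := hg.mono hTU hTsa
  have hWc : ∀ i, ContinuousOn (W i) T := fun i x hx => (hWd i x (hTU hx)).continuousAt.continuousWithinAt
  have huc : ∀ j, ContinuousOn (u j) T := fun j x hx => (hud j x (hTU hx)).continuousAt.continuousWithinAt
  have hidT : ∀ x ∈ T, ∑ i, h i x * Real.log (W i x) + ∑ j, p j x * Real.arctan (u j x) = g x :=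
    fun x hx => hid x (hTU hx)
  rcases T.eq_empty_or_nonempty with rfl | ⟨x₁, hx₁⟩
  · exact circleStructExact_empty
  have hdichH : ∀ i, (∀ x ∈ T, dH i x = 0) ∨ (∀ x ∈ T, dH i x ≠ 0) := fun i => by
    simpa only [Fin.append_left] using hdich (Fin.castAdd l i)
  have hdichP : ∀ j, (∀ x ∈ T, dP j x = 0) ∨ (∀ x ∈ T, dP j x ≠ 0) := fun j => by
    simpa only [Fin.append_right] using hdich (Fin.natAdd k j)
  by_cases hmov : (∃ i, ∀ x ∈ T, dH i x ≠ 0) ∨ (∃ j, ∀ x ∈ T, dP j x ≠ 0)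
  · rcases hmov with ⟨i₁, hi₁⟩ | ⟨j₁, hj₁⟩
    · -- case (b): a returned EXACT multiplicative relation involves the index `i₁`
      have hne : ∑ r, q r x₁ * (f r i₁ : ℝ) ≠ 0 := by
        rw [← hdHq i₁ x₁ (hTJ hx₁)]
        exact hi₁ x₁ hx₁
      obtain ⟨r₀, -, hr₀⟩ := Finset.exists_ne_zero_of_sum_ne_zero hne
      have hf₀ : f r₀ i₁ ≠ 0 := by
        rintro h0
        exact hr₀ (by rw [h0, Int.cast_zero, mul_zero])
      have hrel₀ : ∀ x ∈ T, ∏ i, W i x ^ (f r₀ i) = 1 := fun x hx => hrel r₀ x (hTJ hx)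
      have hidr := circle_identity_elimLog hW0T (f r₀) i₁ hrel₀ hidT
      have hhr : ∀ i, IsSemialgebraicFunOn ℚ T (fun x => h i x - h i₁ x * ((f r₀ i : ℝ) / (f r₀ i₁ : ℝ))) :=
        fun i => (IsSemialgebraicFunOn.sub_holds (hhT i) (IsSemialgebraicFunOn.mul_holds (hhT i₁)
          (isSemialgebraicFunOn_const_ratCast hTsa ((f r₀ i : ℚ) / (f r₀ i₁ : ℚ))))).congr fun x _ => by
            simp only [Pi.sub_apply, Pi.mul_apply]; push_cast; ring
      have hz : ∀ x ∈ T, h i₁ x - h i₁ x * ((f r₀ i₁ : ℝ) / (f r₀ i₁ : ℝ)) = 0 := fun x _ => by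
        rw [div_self (show (f r₀ i₁ : ℝ) ≠ 0 by exact_mod_cast hf₀), mul_one, sub_self]
      exact circleStructExact_elimLog hhT (f r₀) i₁ hf₀ hrel₀
        (exact_of_zeroLog IH hTsa hhr hWT hW0T hpT huT hgT hidr i₁ hz)
    · -- case (b′): a returned EXACT angle relation involves the index `j₁`
      have hne : ∑ s, q' s x₁ * (f' s j₁ : ℝ) ≠ 0 := by
        rw [← hdPq j₁ x₁ (hTJ hx₁)]
        exact hj₁ x₁ hx₁
      obtain ⟨s₀, -, hs₀⟩ := Finset.exists_ne_zero_of_sum_ne_zero hne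
      have hf₀ : f' s₀ j₁ ≠ 0 := by
        rintro h0
        exact hs₀ (by rw [h0, Int.cast_zero, mul_zero])
      have hrel₀ : ∀ x ∈ T, ∑ j, (f' s₀ j : ℝ) * Real.arctan (u j x) = 0 := fun x hx => hrel' s₀ x (hTJ hx)
      have hidr := circle_identity_elimAngle (h := h) (W := W) (f' s₀) j₁ hrel₀ hidT
      have hpr : ∀ j, IsSemialgebraicFunOn ℚ T (fun x => p j x - p j₁ x * ((f' s₀ j : ℝ) / (f' s₀ j₁ : ℝ))) :=
        fun j => (IsSemialgebraicFunOn.sub_holds (hpT j) (IsSemialgebraicFunOn.mul_holds (hpT j₁)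
          (isSemialgebraicFunOn_const_ratCast hTsa ((f' s₀ j : ℚ) / (f' s₀ j₁ : ℚ))))).congr fun x _ => by
            simp only [Pi.sub_apply, Pi.mul_apply]; push_cast; ring
      have hz : ∀ x ∈ T, p j₁ x - p j₁ x * ((f' s₀ j₁ : ℝ) / (f' s₀ j₁ : ℝ)) = 0 := fun x _ => by
        rw [div_self (show (f' s₀ j₁ : ℝ) ≠ 0 by exact_mod_cast hf₀), mul_one, sub_self]
      exact circleStructExact_elimAngle hpT (f' s₀) j₁ hf₀ hrel₀
        (exact_of_zeroAngle IH hTsa hhT hWT hW0T hpr huT hgT hidr j₁ hz)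
  · -- case (a): every derivative vanishes on `T` ⇒ `H`, `P` constant ⇒ projectively constant coefficients
    push Not at hmov
    obtain ⟨hmH, hmP⟩ := hmov
    have hHz : ∀ i, ∀ x ∈ T, dH i x = 0 := fun i => (hdichH i).resolve_right fun hne => by
      obtain ⟨x, hx, h0⟩ := hmH i
      exact hne x hx h0
    have hPz : ∀ j, ∀ x ∈ T, dP j x = 0 := fun j => (hdichP j).resolve_right fun hne => by
      obtain ⟨x, hx, h0⟩ := hmP j
      exact hne x hx h0
    have hHc : ∀ i, ∀ x ∈ T, ∀ y ∈ T, H i x = H i y := fun i =>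
      eq_of_fderiv_single_eq_zero hTo hTc (fun x hx => (hHd i x (hTU hx)).differentiableWithinAt) fun x hx => by
        rw [← hdH i x (hTU hx)]
        exact hHz i x hx
    have hPc : ∀ j, ∀ x ∈ T, ∀ y ∈ T, P j x = P j y := fun j =>
      eq_of_fderiv_single_eq_zero hTo hTc (fun x hx => (hPd j x (hTU hx)).differentiableWithinAt) fun x hx => by
        rw [← hdP j x (hTU hx)]
        exact hPz j x hx
    exact circleStructExact_projConstCoeff hTsa hTo hhT hWT hWc hW0T hpT huT huc hgT (hφ.mono hTU hTsa)
      (fun x hx => hφ0 x (hTU hx)) (fun i => H i x₁) (fun j => P j x₁)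
      (fun i x hx => by rw [hhH i x (hTU hx), hHc i x hx x₁ hx₁])
      (fun j x hx => by rw [hpP j x (hTU hx), hPc j x hx x₁ hx₁]) hidT

/-! #### §24e One round on a prepared cell, the round from all lower levels, and THE LOOP. -/

/-- **One round on a prepared cell**: `U ⊆ ℝ¹` open `ℚ`-sa, the data differentiable on `U`, and `φ` — one of the coefficients —
nowhere `0` on `U`.  Normalise by `φ`, differentiate (§20); the `φ`-slot coefficient of the differentiated identity is `∂(φ/φ) ≡ 0`,
so §24c yields EXACT structure data for the derivatives of the normalised coefficients, and §24d concludes. -/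
theorem circleStructExact_round {k l : ℕ} (IH : ∀ k' l', k' + l' < k + l → ExactLevel k' l')
    {U : Set (Fin 1 → ℝ)} (hU : IsSemialgebraic ℚ U) (hUo : IsOpen U)
    {h W : Fin k → (Fin 1 → ℝ) → ℝ} {p u : Fin l → (Fin 1 → ℝ) → ℝ} {g : (Fin 1 → ℝ) → ℝ}
    (hh : ∀ i, IsSemialgebraicFunOn ℚ U (h i)) (hW : ∀ i, IsSemialgebraicFunOn ℚ U (W i))
    (hW0 : ∀ i, ∀ x ∈ U, 0 < W i x)
    (hp : ∀ j, IsSemialgebraicFunOn ℚ U (p j)) (hu : ∀ j, IsSemialgebraicFunOn ℚ U (u j))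
    (hg : IsSemialgebraicFunOn ℚ U g)
    (hhd : ∀ i, ∀ x ∈ U, DifferentiableAt ℝ (h i) x) (hWd : ∀ i, ∀ x ∈ U, DifferentiableAt ℝ (W i) x)
    (hpd : ∀ j, ∀ x ∈ U, DifferentiableAt ℝ (p j) x) (hud : ∀ j, ∀ x ∈ U, DifferentiableAt ℝ (u j) x)
    (hid : ∀ x ∈ U, ∑ i, h i x * Real.log (W i x) + ∑ j, p j x * Real.arctan (u j x) = g x)
    {φ : (Fin 1 → ℝ) → ℝ} (hφ : (∃ i, φ = h i) ∨ (∃ j, φ = p j)) (hφ0 : ∀ x ∈ U, φ x ≠ 0) :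
    CircleStructExactOn k l U h W p u g := by
  classical
  have hφsa : IsSemialgebraicFunOn ℚ U φ := by
    rcases hφ with ⟨i, rfl⟩ | ⟨j, rfl⟩
    exacts [hh i, hp j]
  have hφd : ∀ x ∈ U, DifferentiableAt ℝ φ x := by
    rcases hφ with ⟨i, rfl⟩ | ⟨j, rfl⟩
    exacts [hhd i, hpd j]
  -- the normalised data `hᵢ/φ`, `pⱼ/φ`, `g/φ`
  have hHsa : ∀ i, IsSemialgebraicFunOn ℚ U (fun x => h i x / φ x) := fun i => (hh i).div hφsa hφ0
  have hPsa : ∀ j, IsSemialgebraicFunOn ℚ U (fun x => p j x / φ x) := fun j => (hp j).div hφsa hφ0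
  have hGsa : IsSemialgebraicFunOn ℚ U (fun x => g x / φ x) := hg.div hφsa hφ0
  have hHd : ∀ i, ∀ x ∈ U, DifferentiableAt ℝ (fun x => h i x / φ x) x := fun i x hx =>
    differentiableAt_div_of (hhd i x hx) (hφd x hx) (hφ0 x hx)
  have hPd : ∀ j, ∀ x ∈ U, DifferentiableAt ℝ (fun x => p j x / φ x) x := fun j x hx =>
    differentiableAt_div_of (hpd j x hx) (hφd x hx) (hφ0 x hx)
  have hidN : ∀ x ∈ U, ∑ i, h i x / φ x * Real.log (W i x) + ∑ j, p j x / φ x * Real.arctan (u j x) =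
      g x / φ x := by
    intro x hx
    rw [← hid x hx, add_div, Finset.sum_div, Finset.sum_div]
    congr 1
    · exact Finset.sum_congr rfl fun i _ => by ring
    · exact Finset.sum_congr rfl fun j _ => by ring
  have hGd : ∀ x ∈ U, DifferentiableAt ℝ (fun x => g x / φ x) x :=
    circle_identity_differentiableAt_rhs hUo hHd hWd hW0 hPd hud hidN
  -- the differentiated identity (§20) and the `ℚ`-semialgebraicity of its data
  have hid₁ := circle_identity_fderiv hUo hHd hWd hW0 hPd hud hidN (Pi.single 0 1)
  have hdHsa : ∀ i, IsSemialgebraicFunOn ℚ U (fun x => fderiv ℝ (fun x => h i x / φ x) x (Pi.single 0 1)) :=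
    fun i => IsSemialgebraicFunOn.fderiv_apply_single hUo (hHsa i) (hHd i) 0
  have hdPsa : ∀ j, IsSemialgebraicFunOn ℚ U (fun x => fderiv ℝ (fun x => p j x / φ x) x (Pi.single 0 1)) :=
    fun j => IsSemialgebraicFunOn.fderiv_apply_single hUo (hPsa j) (hPd j) 0
  have hg₁sa := isSemialgebraicFunOn_fderiv_rhs hU hUo hHsa hW hW0 hPsa hu hGsa hWd hud hGd 0
  -- the `φ`-slot has derivative `0`
  have hself : ∀ x ∈ U, fderiv ℝ (fun y => φ y / φ y) x (Pi.single 0 1) = 0 := by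
    intro x hx
    have heq : (fun y => φ y / φ y) =ᶠ[𝓝 x] fun _ => (1 : ℝ) := by
      filter_upwards [hUo.mem_nhds hx] with y hy
      exact div_self (hφ0 y hy)
    rw [heq.fderiv_eq]
    simp
  -- EXACT structure data for the derivatives, from the lower levels (§24c)
  have hE₁ : CircleStructExactOn k l U (fun i x => fderiv ℝ (fun x => h i x / φ x) x (Pi.single 0 1)) W
      (fun j x => fderiv ℝ (fun x => p j x / φ x) x (Pi.single 0 1)) u
      (fun x => fderiv ℝ (fun x => g x / φ x) x (Pi.single 0 1) -
        ∑ i, h i x / φ x * (fderiv ℝ (W i) x (Pi.single 0 1) / W i x) -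
        ∑ j, p j x / φ x * (fderiv ℝ (u j) x (Pi.single 0 1) / (1 + u j x ^ 2))) := by
    rcases hφ with ⟨i₀, rfl⟩ | ⟨j₀, rfl⟩
    · exact exact_of_zeroLog IH hU hdHsa hW hW0 hdPsa hu hg₁sa hid₁ i₀ hself
    · exact exact_of_zeroAngle IH hU hdHsa hW hW0 hdPsa hu hg₁sa hid₁ j₀ hself
  -- conclude (§24d)
  have hhH : ∀ i, ∀ x ∈ U, h i x = φ x * (h i x / φ x) := fun i x hx => by
    rw [← mul_div_assoc, mul_div_cancel_left₀ _ (hφ0 x hx)]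
  have hpP : ∀ j, ∀ x ∈ U, p j x = φ x * (p j x / φ x) := fun j x hx => by
    rw [← mul_div_assoc, mul_div_cancel_left₀ _ (hφ0 x hx)]
  exact circleStructExact_of_derivData IH hh hW hW0 hp hu hg hWd hud hid hφsa hφ0
    (H := fun i x => h i x / φ x) (P := fun j x => p j x / φ x) hhH hpP hHd hPd
    (dH := fun i x => fderiv ℝ (fun x => h i x / φ x) x (Pi.single 0 1))
    (dP := fun j x => fderiv ℝ (fun x => p j x / φ x) x (Pi.single 0 1))
    (fun _ _ _ => rfl) (fun _ _ _ => rfl) hdHsa hdPsa hE₁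

open scoped ContDiff in
/-- **The round**: the level `(k, l)` from all lower levels (localise by §24a to interval cells with smooth data on which every
coefficient is `≡ 0` or nowhere `0`; all `≡ 0` ⇒ §18 with `φ = 1`; else §24e `circleStructExact_round`). -/
theorem exactLevel_of_lower (k l : ℕ) (IH : ∀ k' l', k' + l' < k + l → ExactLevel k' l') : ExactLevel k l := by
  classical
  intro U h W p u g hU hh hW hW0 hp hu hg hid
  refine circleStructExact_localise hU (Fin.append (Fin.append h W) (Fin.append p u)) ?_ (Fin.append h p) ?_ ?_
  · intro t
    induction t using Fin.addCases with
    | left t =>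
      induction t using Fin.addCases with
      | left i => simpa only [Fin.append_left] using hh i
      | right i => simpa only [Fin.append_left, Fin.append_right] using hW i
    | right t =>
      induction t using Fin.addCases with
      | left j => simpa only [Fin.append_right, Fin.append_left] using hp j
      | right j => simpa only [Fin.append_right] using hu j
  · intro t
    induction t using Fin.addCases with
    | left i => simpa only [Fin.append_left] using hh i
    | right j => simpa only [Fin.append_right] using hp j
  intro T hTU hTsa hTo hTc hsm hdich
  -- restrictions to `T` and differentiability on the open cell `T`
  have hhT : ∀ i, IsSemialgebraicFunOn ℚ T (h i) := fun i => (hh i).mono hTU hTsa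
  have hWT : ∀ i, IsSemialgebraicFunOn ℚ T (W i) := fun i => (hW i).mono hTU hTsa
  have hW0T : ∀ i, ∀ x ∈ T, 0 < W i x := fun i x hx => hW0 i x (hTU hx)
  have hpT : ∀ j, IsSemialgebraicFunOn ℚ T (p j) := fun j => (hp j).mono hTU hTsa
  have huT : ∀ j, IsSemialgebraicFunOn ℚ T (u j) := fun j => (hu j).mono hTU hTsa
  have hgT : IsSemialgebraicFunOn ℚ T g := hg.mono hTU hTsa
  have hidT : ∀ x ∈ T, ∑ i, h i x * Real.log (W i x) + ∑ j, p j x * Real.arctan (u j x) = g x :=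
    fun x hx => hid x (hTU hx)
  have hdiff : ∀ t, ∀ x ∈ T, DifferentiableAt ℝ (Fin.append (Fin.append h W) (Fin.append p u) t) x :=
    fun t x hx => ((hsm t).differentiableOn (by simp)).differentiableAt (hTo.mem_nhds hx)
  have hhd : ∀ i, ∀ x ∈ T, DifferentiableAt ℝ (h i) x := fun i => by
    simpa only [Fin.append_left] using hdiff (Fin.castAdd (l + l) (Fin.castAdd k i))
  have hWd : ∀ i, ∀ x ∈ T, DifferentiableAt ℝ (W i) x := fun i => by
    simpa only [Fin.append_left, Fin.append_right] using hdiff (Fin.castAdd (l + l) (Fin.natAdd k i))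
  have hpd : ∀ j, ∀ x ∈ T, DifferentiableAt ℝ (p j) x := fun j => by
    simpa only [Fin.append_right, Fin.append_left] using hdiff (Fin.natAdd (k + k) (Fin.castAdd l j))
  have hud : ∀ j, ∀ x ∈ T, DifferentiableAt ℝ (u j) x := fun j => by
    simpa only [Fin.append_right] using hdiff (Fin.natAdd (k + k) (Fin.natAdd l j))
  by_cases hex : ∃ t, ∀ x ∈ T, Fin.append h p t x ≠ 0
  · obtain ⟨t, ht⟩ := hex
    have hφ : (∃ i, Fin.append h p t = h i) ∨ (∃ j, Fin.append h p t = p j) := by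
      induction t using Fin.addCases with
      | left i => exact Or.inl ⟨i, by simp only [Fin.append_left]⟩
      | right j => exact Or.inr ⟨j, by simp only [Fin.append_right]⟩
    exact circleStructExact_round IH hTsa hTo hhT hWT hW0T hpT huT hgT hhd hWd hpd hud hidT hφ ht
  · push Not at hex
    have hz : ∀ t, ∀ x ∈ T, Fin.append h p t x = 0 := fun t => (hdich t).resolve_right fun hne => by
      obtain ⟨x, hx, h0⟩ := hex t
      exact hne x hx h0
    have h1 : IsSemialgebraicFunOn ℚ T (fun _ => (1 : ℝ)) :=
      (isSemialgebraicFunOn_const_ratCast hTsa 1).congr fun _ _ => by simp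
    exact circleStructExact_projConstCoeff hTsa hTo hhT hWT
      (fun i x hx => (hWd i x hx).continuousAt.continuousWithinAt) hW0T hpT huT
      (fun j x hx => (hud j x hx).continuousAt.continuousWithinAt) hgT h1 (fun _ _ => one_ne_zero)
      (fun _ => 0) (fun _ => 0)
      (fun i x hx => by simpa only [Fin.append_left, mul_zero] using hz (Fin.castAdd l i) x hx)
      (fun j x hx => by simpa only [Fin.append_right, mul_zero] using hz (Fin.natAdd k j) x hx) hidT

/-- **THE LOOP**: every level holds (strong induction on the number of terms `k + l`). -/
theorem exactLevel_all (k l : ℕ) : ExactLevel k l := by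
  suffices H : ∀ N k l, k + l = N → ExactLevel k l from H _ k l rfl
  intro N
  induction N using Nat.strong_induction_on with
  | _ N IHN =>
    intro k l hkl
    exact exactLevel_of_lower k l fun k' l' hlt => IHN (k' + l') (hkl ▸ hlt) k' l' rfl

end G13
end Summit.KontsevichZagierPeriods.RootDecompRelativeModAbsolute.Rung30571.RegularisedLogLayer.CylLog.Leaf
end
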